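import Summits.ResolutionOfSingularities.ResolutionOfSingularities.Theorems.EquisingularLiftEquisingularLiftNatRibbonTouchNotFinishing
import Summits.ResolutionOfSingularities.ResolutionOfSingularities.Theorems.EquisingularLiftEquisingularLiftNatBlowupChartPoint
import Literature.AlgebraicGeometry.Resolution.PointBlowupAlgebraCharts
import HarnessLib

/-!
# [OURS · L1 W4.5(b) · EL♮] K-RIBBON AT SCHEME LEVEL: for ANY blowing up of the strict-transform germ along an ideal sheaf whose
# stalk at `x_j` is the ribbon trace `(ū₁, ū₂)`, some point over `x_j` is NOT regular
# (crux `EquisingularLiftNat` = stmt-ResolutionOfSingularities-20038; K-∀n / K5-BMY necessity lane, kill test #50)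

HONEST FRAMING. OURS (cell res-hironaka, crux chain w45b, slot W4.5(b)); NOT a statement of any manuscript; replaces the role of
NOTHING in the manuscript; AI-written, AI review is weaker than expert review. Helper `--supports stmt-ResolutionOfSingularities-20038
--as helper`. Composition of the ring theorem K-RIBBON (`RibbonTouch.exists_prime_not_isRegularLocalRing`, p541471; res-L1-w45b-strat-1
STRATEGY-CENSUS v10 N5.1) with the scheme reader (`ChartPoint.exists_point_not_isRegularLocalRing_of_chart`, p550611).

* `exists_prime_not_isRegularLocalRing_congr` — TRANSPORT along a ring isomorphism `e : A ≅ A′` of local rings: a prime of `A[I/a]`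
  over `𝔪_A` with non-regular localisation gives one of `A′[e(I)/e(a)]` over `𝔪_{A′}` (`blowupAlgebra.congrEquiv`, p-Literature
  `PointBlowupAlgebraCharts`; localisations compared by `IsLocalization.ringEquivOfRingEquiv`).
* `exists_prime_not_isRegularLocalRing_of_surjective` — K-RIBBON for a PRESENTED local ring: `R` regular local with regular system of
  parameters `(c₀, c₁, t)`, `g ∈ 𝔪_R²` with `g − ε t² ∈ (c₀, c₁)` (`ε` a unit), `q : R ↠ A` with kernel `(g)` (e.g. `A = 𝒪_{Y_j, x_j}`,
  `R = 𝒪_{P_s, x_j}`): the chart `A[(q c₀, q c₁)/q c₀]` has a prime over `𝔪_A` with non-regular localisation.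
* `exists_point_not_isRegularLocalRing_of_isBlowup` — THE SCHEME STATEMENT: if moreover `A = 𝒪_{Y,s}` and `π : Y′ → Y` is a blowing
  up (`IsBlowup π J`) along an ideal sheaf `J` with `J_s = (q c₀, q c₁)` — the trace of a RIBBON centre (`RibbonTouch.trace_eq`) — then
  some `y′ ∈ Y′` with `π y′ = s` has a NON-regular local ring: a ribbon touch at an anisotropic good 2-dimensional germ is never the
  finishing touch (the `r = 3`, `m ≥ 2` twin of `not_finishing_of_fatTouch_of_aniso`, p522183).

References: tree p541471, p550611, `Literature…PointBlowupAlgebraCharts` (`blowupAlgebra.congrEquiv`); [StacksProject, Tags 0804, 080E];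
[Matsumura1987, Thm. 14.2].
-/

set_option linter.dupNamespace false -- mandated namespace `Summit.<Summit>.<Problem>` of this single-conjunct summit

noncomputable section

universe u

open CategoryTheory AlgebraicGeometry TopologicalSpace IsLocalRing
open Literature.AlgebraicGeometry.Resolution
open AlgebraicGeometry.Scheme.IdealSheafData

namespace Summit.ResolutionOfSingularities.ResolutionOfSingularities.Cruxes.EquisingularLiftNat.Sections

namespace RibbonTouch

/-! ## Transport along a ring isomorphism of the base -/

/-- For a ring isomorphism `e : A ≅ A′` of local rings, `r′ ∈ 𝔪_{A′} ↔ e⁻¹ r′ ∈ 𝔪_A`. [folklore] -/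
theorem mem_maximalIdeal_iff_symm_mem {A A' : Type u} [CommRing A] [CommRing A'] [IsLocalRing A] [IsLocalRing A']
    (e : A ≃+* A') (r' : A') : r' ∈ maximalIdeal A' ↔ e.symm r' ∈ maximalIdeal A := by
  rw [IsLocalRing.mem_maximalIdeal, IsLocalRing.mem_maximalIdeal, mem_nonunits_iff, mem_nonunits_iff, not_iff_not]
  constructor
  · intro h
    exact (isUnit_map_iff e.symm r').mpr h
  · intro h
    have := (isUnit_map_iff e (e.symm r')).mpr h
    rwa [RingEquiv.apply_symm_apply] at this

/-- **Transport of «a prime over `𝔪` of `A[I/a]` with non-regular localisation» along `e : A ≅ A′`** (local rings), to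
`A′[e(I)/e(a)]` (`blowupAlgebra.congrEquiv`). [folklore] -/
theorem exists_prime_not_isRegularLocalRing_congr {A A' : Type u} [CommRing A] [CommRing A'] [IsLocalRing A] [IsLocalRing A']
    (e : A ≃+* A') (I : Ideal A) (a : A)
    (h : ∃ (𝔓 : Ideal (blowupAlgebra I a)) (_ : 𝔓.IsPrime),
      𝔓.comap (algebraMap A (blowupAlgebra I a)) = maximalIdeal A ∧ ¬ IsRegularLocalRing (Localization.AtPrime 𝔓)) :
    ∃ (𝔓' : Ideal (blowupAlgebra (I.map e.toRingHom) (e a))) (_ : 𝔓'.IsPrime),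
      𝔓'.comap (algebraMap A' (blowupAlgebra (I.map e.toRingHom) (e a))) = maximalIdeal A' ∧
        ¬ IsRegularLocalRing (Localization.AtPrime 𝔓') := by
  obtain ⟨𝔓, h𝔓, hcomap, hnr⟩ := h
  let ε : blowupAlgebra I a ≃+* blowupAlgebra (I.map e.toRingHom) (e a) := blowupAlgebra.congrEquiv e I a
  let 𝔓' : Ideal (blowupAlgebra (I.map e.toRingHom) (e a)) := 𝔓.comap ε.symm.toRingHom
  haveI h𝔓' : 𝔓'.IsPrime := by change (𝔓.comap ε.symm.toRingHom).IsPrime; infer_instance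
  have hmem : ∀ b, b ∈ 𝔓' ↔ ε.symm b ∈ 𝔓 := fun b => Iff.rfl
  refine ⟨𝔓', h𝔓', ?_, ?_⟩
  · ext r'
    rw [Ideal.mem_comap, hmem, mem_maximalIdeal_iff_symm_mem e, ← hcomap, Ideal.mem_comap]
    have hr : algebraMap A' (blowupAlgebra (I.map e.toRingHom) (e a)) r' = ε (algebraMap A (blowupAlgebra I a) (e.symm r')) := by
      rw [show (ε : blowupAlgebra I a → _) = blowupAlgebra.congrEquiv e I a from rfl, blowupAlgebra.congrEquiv_algebraMap,
        RingEquiv.apply_symm_apply]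
    rw [hr, RingEquiv.symm_apply_apply]
  · -- `(A′[…])_{𝔓′} ≅ (A[I/a])_𝔓`
    have H : Submonoid.map (RingEquiv.toMonoidHom ε) 𝔓.primeCompl = 𝔓'.primeCompl := by
      ext b
      constructor
      · rintro ⟨x, hx, rfl⟩
        intro hb
        exact hx (by
          have hb' := (hmem _).mp hb
          rwa [show ε.symm ((RingEquiv.toMonoidHom ε) x) = x from ε.symm_apply_apply x] at hb')
      · intro hb
        refine ⟨ε.symm b, fun hx => hb ((hmem b).mpr hx), ε.apply_symm_apply b⟩
    have e₃ : Localization.AtPrime 𝔓 ≃+* Localization.AtPrime 𝔓' :=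
      IsLocalization.ringEquivOfRingEquiv (M := 𝔓.primeCompl) (T := 𝔓'.primeCompl)
        (Localization.AtPrime 𝔓) (Localization.AtPrime 𝔓') (h := ε) H
    intro hreg
    exact hnr (@IsRegularLocalRing.of_ringEquiv _ _ hreg _ _ e₃.symm)

/-! ## K-RIBBON for a presented local ring `q : R ↠ A`, `ker q = (g)` -/

section Presented

variable {R : Type u} [CommRing R] [IsRegularLocalRing R] (c : Fin 2 → R) (t : R)
  (hz : Ideal.span (Set.range (Fin.append c ![t])) = maximalIdeal R)
  (hd : (maximalIdeal R).spanFinrank = 2 + 1)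
  (g ε : R) (hε : IsUnit ε) (hg2 : g ∈ maximalIdeal R ^ 2) (hgt : g - ε * t ^ 2 ∈ Ideal.span (Set.range c))
  {A : Type u} [CommRing A] [IsLocalRing A] (q : R →+* A) (hq : Function.Surjective q)
  (hker : RingHom.ker q = Ideal.span {g})

include hz hd hε hg2 hgt hq hker in
/-- **K-RIBBON for a presented local ring** (`A ≅ R/(g)` via `q`): the chart `A[(q c₀, q c₁)/q c₀]` of the blow-up of `Spec A` along the
ribbon trace `(q c₀, q c₁)` has a prime over `𝔪_A` whose localisation is NOT regular. OURS. -/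
theorem exists_prime_not_isRegularLocalRing_of_surjective :
    ∃ (𝔓 : Ideal (blowupAlgebra (Ideal.span (Set.range fun i => q (c i))) (q (c 0)))) (_ : 𝔓.IsPrime),
      𝔓.comap (algebraMap A (blowupAlgebra (Ideal.span (Set.range fun i => q (c i))) (q (c 0)))) = maximalIdeal A ∧
        ¬ IsRegularLocalRing (Localization.AtPrime 𝔓) := by
  -- `e : R/(g) ≅ A` with `e (r mod g) = q r`
  let e : (R ⧸ Ideal.span {g}) ≃+* A :=
    (Ideal.quotEquivOfEq hker.symm).trans (RingHom.quotientKerEquivOfSurjective hq)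
  have he : ∀ r, e (Ideal.Quotient.mk (Ideal.span {g}) r) = q r := fun r => by
    change RingHom.quotientKerEquivOfSurjective hq (Ideal.quotEquivOfEq hker.symm (Ideal.Quotient.mk _ r)) = q r
    rw [Ideal.quotEquivOfEq_mk, RingHom.quotientKerEquivOfSurjective_apply_mk]
  -- the quotient `R/(g)` is local
  haveI : Nontrivial (R ⧸ Ideal.span {g}) :=
    Ideal.Quotient.nontrivial_iff.mpr (Ideal.span_singleton_ne_top (fun hu =>
      (maximalIdeal.isMaximal R).ne_top (Ideal.eq_top_of_isUnit_mem _ (Ideal.pow_le_self two_ne_zero hg2) hu)))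
  haveI : IsLocalRing (R ⧸ Ideal.span {g}) :=
    IsLocalRing.of_surjective' (Ideal.Quotient.mk (Ideal.span {g})) Ideal.Quotient.mk_surjective
  -- K-RIBBON over `R/(g)`
  obtain ⟨𝔓, h𝔓, hcomap, hnr⟩ := exists_prime_not_isRegularLocalRing (c := c) (t := t) hz hd g ε hε hg2 hgt
  have hmax : (maximalIdeal R).map (Ideal.Quotient.mk (Ideal.span {g})) = maximalIdeal (R ⧸ Ideal.span {g}) :=
    (maximalIdeal_quotient_eq_map (Ideal.span {g})).symm
  have h0 : ∃ (𝔓 : Ideal (blowupAlgebra ((Ideal.span (Set.range c)).map (Ideal.Quotient.mk (Ideal.span {g})))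
      (Ideal.Quotient.mk (Ideal.span {g}) (c 0)))) (_ : 𝔓.IsPrime),
      𝔓.comap (algebraMap _ _) = maximalIdeal (R ⧸ Ideal.span {g}) ∧ ¬ IsRegularLocalRing (Localization.AtPrime 𝔓) :=
    ⟨𝔓, h𝔓, hcomap.trans hmax, hnr⟩
  -- transport along `e`
  have h1 := exists_prime_not_isRegularLocalRing_congr e _ _ h0
  have hJ : ((Ideal.span (Set.range c)).map (Ideal.Quotient.mk (Ideal.span {g}))).map e.toRingHom =
      Ideal.span (Set.range fun i => q (c i)) := by
    rw [Ideal.map_map, Ideal.map_span, ← Set.range_comp]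
    have hfun : (⇑((e.toRingHom).comp (Ideal.Quotient.mk (Ideal.span {g}))) ∘ c) = fun i => q (c i) :=
      funext fun i => he (c i)
    rw [hfun]
  have hb : e (Ideal.Quotient.mk (Ideal.span {g}) (c 0)) = q (c 0) := he (c 0)
  have key : ∀ (J' : Ideal A) (b' : A),
      ((Ideal.span (Set.range c)).map (Ideal.Quotient.mk (Ideal.span {g}))).map e.toRingHom = J' →
      e (Ideal.Quotient.mk (Ideal.span {g}) (c 0)) = b' →
      ∃ (𝔓 : Ideal (blowupAlgebra J' b')) (_ : 𝔓.IsPrime),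
        𝔓.comap (algebraMap A (blowupAlgebra J' b')) = maximalIdeal A ∧ ¬ IsRegularLocalRing (Localization.AtPrime 𝔓) := by
    rintro _ _ rfl rfl
    exact h1
  exact key _ _ hJ hb

end Presented

/-! ## The scheme statement -/

/-- **K-RIBBON AT SCHEME LEVEL (N5.1): a ribbon touch at an anisotropic good 2-dimensional germ is never the finishing touch.**
Let `Y` be a scheme and `s ∈ Y` with `𝒪_{Y,s}` presented as `q : R ↠ 𝒪_{Y,s}`, `ker q = (g)`, where `R` is a regular local ring of
dimension `3` with regular system of parameters `(c₀, c₁, t)`, `g ∈ 𝔪_R²` and `g − ε t² ∈ (c₀, c₁)` (`ε` a unit — the anisotropy clause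
«`q(0,0,1) ≠ 0`»); let `π : Y′ → Y` be a blowing up along an ideal sheaf `J` with `J_s = (q c₀, q c₁)` (the trace of every ribbon centre
`V(u₁, u₂, ϖ − ε′t^m)`, `m ≥ 2`: `RibbonTouch.trace_eq`). Then some `y′ ∈ Y′` with `π y′ = s` has a NON-regular local ring. OURS. -/
theorem exists_point_not_isRegularLocalRing_of_isBlowup {R : Type} [CommRing R] [IsRegularLocalRing R] (c : Fin 2 → R) (t : R)
    (hz : Ideal.span (Set.range (Fin.append c ![t])) = maximalIdeal R) (hd : (maximalIdeal R).spanFinrank = 2 + 1)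
    (g ε : R) (hε : IsUnit ε) (hg2 : g ∈ maximalIdeal R ^ 2) (hgt : g - ε * t ^ 2 ∈ Ideal.span (Set.range c))
    {Y' Y : Scheme.{0}} {π : Y' ⟶ Y} {J : Y.IdealSheafData} (hπ : IsBlowup π J) (s : Y)
    (q : R →+* Y.presheaf.stalk s) (hq : Function.Surjective q) (hker : RingHom.ker q = Ideal.span {g})
    (hJ : stalkIdeal J s = Ideal.span (Set.range fun i => q (c i))) :
    ∃ y' : Y', π y' = s ∧ ¬ IsRegularLocalRing (Y'.presheaf.stalk y') := by
  obtain ⟨𝔓, h𝔓, hcomap, hnr⟩ :=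
    exists_prime_not_isRegularLocalRing_of_surjective c t hz hd g ε hε hg2 hgt q hq hker
  haveI := h𝔓
  exact ChartPoint.exists_point_not_isRegularLocalRing_of_chart hπ s (fun i => q (c i)) hJ.symm 0 𝔓 hcomap hnr

end RibbonTouch

end Summit.ResolutionOfSingularities.ResolutionOfSingularities.Cruxes.EquisingularLiftNat.Sections
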